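import Summits.ResolutionOfSingularities.ResolutionOfSingularities.Theorems.EquisingularLiftEquisingularLiftNatPointStep
import Summits.ResolutionOfSingularities.ResolutionOfSingularities.Theorems.EquisingularLiftEquisingularLiftNatStubElnatLeTwo
import HarnessLib

/-!
# [OURS · L1 W4.5(b) · EL♮] T-ISO-0 «POINT-ONLY DOWNSTAIRS EMBEDDED RESOLUTIONS LIFT TO HORIZONTAL E1 SECTION CHAINS», any `n`
# (res-L1-w45b-lead-2's TARGET `L/res-L1-w45b-lead-2/TARGET-T-ISO-0.lean` d0ee84fae5c3adea, signature VERBATIM; brick 3 = assembly)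

Crux `EquisingularLiftNat` = stmt-ResolutionOfSingularities-20038 (route EquisingularLift), line `sections`; helper file
`--supports … --as helper` by res-D-pv-029 (T-ISO-0 first call, res-plan-2 D→L MAP v1.14a/b 2026-08-27). HONEST FRAMING: OURS (cell
res-hironaka, slot W4.5(b)); NOT a statement of any manuscript; inside S's known regime (a rung: the hypersurfaces whose embedded
resolution DOWNSTAIRS is a finite chain of blow-ups at non-regular closed points — absolutely isolated singularities once the classical
downstairs statement is supplied; recovers `stub_elnat_le_two`). AI-written, weaker than expert review. No `sorry`; standard axioms.

STATEMENT (`target_elnat_of_pointResolution`, lead-2's draft signature verbatim). If the integral hypersurface `H ⊆ ℙⁿ_k` is resolved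
DOWNSTAIRS by a finite chain of blow-ups of the successive ambients at NON-REGULAR CLOSED POINTS of the successive reduced strict
transforms (the inductive closure in the hypothesis), then the HORIZONTAL form of EL♮ holds for `H`: over `O = 𝕎(k)` there is a chain of
blow-ups of `ℙⁿ_O` along regular, `O`-FLAT centres lying over non-generic points of `Y` and meeting the special fibre inside the current
strict transform (E1), ending with a regular reduced strict transform.

PROOF. `O := 𝕎(k)` and the fixed ambient `P = ℙⁿ_O` exactly as in `stub_elnat_le_two` (p498502). Induction ALONG THE GIVEN DOWNSTAIRS
CHAIN with the predicate «`T` closed irreducible, `F` locally Noetherian, and SOME upstairs horizontal-E1 stage `(X', σ', S')` with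
irreducible special fibre and good reduction at every special-fibre point has its reduced strict transform ISOMORPHIC to the downstairs
one, `V(closure T)_red ≅ V(closure S')_red`»: the base case is `V(range ι)_red ≅ H ≅ V(Y)_red`; the step is `pointStep` (brick 2,
p505032: a Hensel SECTION through the corresponding upstairs point, brick 1 p504357 transporting the isomorphism through the two point
blow-ups of the reduced strict transforms); at the end the downstairs regularity transports through the isomorphism. No identification
of ambient special fibres is ever needed.

References: Theorems/EquisingularLiftEquisingularLiftNatStubElnatLeTwo.lean (ambient block, le_two), …NatPointStep.lean, …NatPointStepTransport.lean;
Liu 2002 §8.1/§9.2, Kollár 2007 §1.4; L/w45b/CRUX-PLAN.md v3; res-L1-w45b-lead-2 RESHAPE v3 2026-08-27T05:49:11Z.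
-/

set_option linter.dupNamespace false -- mandated namespace `Summit.<Summit>.<Problem>` of this single-conjunct summit
set_option linter.overlappingInstances false -- signatures carry `[IsDomain O] [IsDiscreteValuationRing O]`

noncomputable section

open CategoryTheory CategoryTheory.Limits AlgebraicGeometry TopologicalSpace Topology
open MvPolynomial HomogeneousIdeal
open Literature.AlgebraicGeometry.Resolution
open AlgebraicGeometry.Scheme.IdealSheafData
open Summit.ResolutionOfSingularities.ResolutionOfSingularities.Theses.EquisingularLift.Split
open Summit.ResolutionOfSingularities.ResolutionOfSingularities.Cruxes.EquisingularLift.StrataSplit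

namespace Summit.ResolutionOfSingularities.ResolutionOfSingularities.Cruxes.EquisingularLiftNat.Sections

/-- The reduced closed subscheme on the (closed) image of a closed immersion from a reduced scheme is isomorphic to the source.
[folklore] -/
theorem nonempty_iso_subscheme_vanishingIdeal_range {H X : Scheme.{0}} [IsReduced H] (f : H ⟶ X) [IsClosedImmersion f] :
    Nonempty ((vanishingIdeal (⟨Set.range f, f.isClosedEmbedding.isClosed_range⟩ : Closeds X)).subscheme ≅ H) := by
  set Yc : Closeds X := ⟨Set.range f, f.isClosedEmbedding.isClosed_range⟩ with hYc
  have hYker : vanishingIdeal Yc = f.ker := by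
    rw [← Scheme.IdealSheafData.map_bot, ← Scheme.nilradical_eq_bot, ← Scheme.IdealSheafData.vanishingIdeal_top,
      Scheme.IdealSheafData.map_vanishingIdeal]
    congr 1
    ext1
    change Set.range f = closure (f '' Set.univ)
    rw [Set.image_univ, f.isClosedEmbedding.isClosed_range.closure_eq]
  have hker : (vanishingIdeal Yc).subschemeι.ker = f.ker := by
    rw [Scheme.IdealSheafData.ker_subschemeι, hYker]
  haveI := IsClosedImmersion.isIso_lift _ f hker
  exact ⟨(asIso (IsClosedImmersion.lift _ f hker.le)).symm⟩

/-- **T-ISO-0 «point-only downstairs embedded resolutions lift to horizontal E1 section chains»** (res-L1-w45b-lead-2's target,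
signature verbatim; see the module docstring). [folklore; Liu 2002 §8.1/§9.2] -/
theorem target_elnat_of_pointResolution (p : ℕ) : p.Prime → ∀ (k : Type) [Field k] [CharP k p] [IsAlgClosed k] (n : ℕ) (H : AlgebraicGeometry.Scheme.{0}) (ι : H ⟶ (Literature.AlgebraicGeometry.Motives.projectiveSpace n k).left), AlgebraicGeometry.IsClosedImmersion ι → AlgebraicGeometry.IsIntegral H → (∀ y : (Literature.AlgebraicGeometry.Motives.projectiveSpace n k).left, ∃ U : (Literature.AlgebraicGeometry.Motives.projectiveSpace n k).left.affineOpens, y ∈ (U : (Literature.AlgebraicGeometry.Motives.projectiveSpace n k).left.Opens) ∧ (ι.ker.ideal U).IsPrincipal) → (∃ (F' : AlgebraicGeometry.Scheme.{0}) (ρ' : F' ⟶ (Literature.AlgebraicGeometry.Motives.projectiveSpace n k).left) (T' : Set F'), (∀ Q : (∀ F₁ : AlgebraicGeometry.Scheme.{0}, (F₁ ⟶ (Literature.AlgebraicGeometry.Motives.projectiveSpace n k).left) → Set F₁ → Prop), Q (Literature.AlgebraicGeometry.Motives.projectiveSpace n k).left (CategoryTheory.CategoryStruct.id (Literature.AlgebraicGeometry.Motives.projectiveSpace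 n k).left) (Set.range ι) → (∀ (F₁ F₂ : AlgebraicGeometry.Scheme.{0}) (ρ : F₁ ⟶ (Literature.AlgebraicGeometry.Motives.projectiveSpace n k).left) (T₁ : Set F₁) (x : ↥(AlgebraicGeometry.Scheme.IdealSheafData.vanishingIdeal (⟨closure T₁, isClosed_closure⟩ : TopologicalSpace.Closeds F₁)).subscheme) (υ : F₂ ⟶ F₁) (hx : IsClosed ({((AlgebraicGeometry.Scheme.IdealSheafData.vanishingIdeal (⟨closure T₁, isClosed_closure⟩ : TopologicalSpace.Closeds F₁)).subschemeι x : F₁)} : Set F₁)), Q F₁ ρ T₁ → ¬ IsRegularLocalRing ((AlgebraicGeometry.Scheme.IdealSheafData.vanishingIdeal (⟨closure T₁, isClosed_closure⟩ : TopologicalSpace.Closeds F₁)).subscheme.presheaf.stalk x) → Literature.AlgebraicGeometry.Resolution.IsBlowup υ (AlgebraicGeometry.Scheme.IdealSheafData.vanishingIdeal (⟨{((AlgebraicGeometry.Scheme.IdealSheafData.vanishingIdeal (⟨closure T₁, isClosed_closure⟩ : TopologicalSpace.Closeds F₁)).subschemeι x : F₁)}, hx⟩ : TopologicalSpace.Closeds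 F₁)) → Q F₂ (CategoryTheory.CategoryStruct.comp υ ρ) (closure (υ ⁻¹' (T₁ \ {((AlgebraicGeometry.Scheme.IdealSheafData.vanishingIdeal (⟨closure T₁, isClosed_closure⟩ : TopologicalSpace.Closeds F₁)).subschemeι x : F₁)})))) → Q F' ρ' T') ∧ Literature.AlgebraicGeometry.Resolution.Scheme.IsRegular (AlgebraicGeometry.Scheme.IdealSheafData.vanishingIdeal (⟨closure T', isClosed_closure⟩ : TopologicalSpace.Closeds F')).subscheme) → ∃ (O : Type) (_ : CommRing O) (_ : IsDomain O) (_ : IsDiscreteValuationRing O) (_ : CharZero O) (π : O →+* k), Function.Surjective π ∧ (letI := MvPolynomial.gradedAlgebra (σ := Fin (n + 1)) (R := O); letI := MvPolynomial.gradedAlgebra (σ := Fin (n + 1)) (R := k); ∀ (φ : MvPolynomial.homogeneousSubmodule (Fin (n + 1)) O →+*ᵍ MvPolynomial.homogeneousSubmodule (Fin (n + 1)) k) (hφ' : HomogeneousIdeal.irrelevant (MvPolynomial.homogeneousSubmodule (Fin (n + 1)) k) ≤ (HomogeneousIdeal.irrelevant (MvPolynomial.homogeneousSubmodule (Fin (n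 + 1)) O)).map φ), (∀ s, φ s = MvPolynomial.map π s) → ∀ Y : Set (AlgebraicGeometry.Proj (MvPolynomial.homogeneousSubmodule (Fin (n + 1)) O)), Y = Set.range (CategoryTheory.CategoryStruct.comp ι (AlgebraicGeometry.Proj.map φ hφ') : H ⟶ (AlgebraicGeometry.Proj (MvPolynomial.homogeneousSubmodule (Fin (n + 1)) O))) → ∃ (P' : AlgebraicGeometry.Scheme.{0}) (σ : P' ⟶ (AlgebraicGeometry.Proj (MvPolynomial.homogeneousSubmodule (Fin (n + 1)) O))) (S' : Set P'), (∀ Q : (∀ X' : AlgebraicGeometry.Scheme.{0}, (X' ⟶ (AlgebraicGeometry.Proj (MvPolynomial.homogeneousSubmodule (Fin (n + 1)) O))) → Set X' → Prop), Q (AlgebraicGeometry.Proj (MvPolynomial.homogeneousSubmodule (Fin (n + 1)) O)) (CategoryTheory.CategoryStruct.id (AlgebraicGeometry.Proj (MvPolynomial.homogeneousSubmodule (Fin (n + 1)) O))) Y → (∀ (X' X'' : AlgebraicGeometry.Scheme.{0}) (σ' : X' ⟶ (AlgebraicGeometry.Proj (MvPolynomial.homogeneousSubmodule (Fin (n + 1))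 O))) (Y' : Set X') (C : X'.IdealSheafData) (τ : X'' ⟶ X'), Q X' σ' Y' → Literature.AlgebraicGeometry.Resolution.IsBlowup τ C → Literature.AlgebraicGeometry.Resolution.Scheme.IsRegular C.subscheme → AlgebraicGeometry.Flat (CategoryTheory.CategoryStruct.comp C.subschemeι (CategoryTheory.CategoryStruct.comp σ' (CategoryTheory.CategoryStruct.comp (AlgebraicGeometry.Proj.toSpecZero (MvPolynomial.homogeneousSubmodule (Fin (n + 1)) O)) (AlgebraicGeometry.Spec.map (CommRingCat.ofHom (algebraMap O (MvPolynomial.homogeneousSubmodule (Fin (n + 1)) O 0))))))) → σ' '' (C.support : Set X') ⊆ {x | ¬ IsGenericPoint x Y} → (C.support : Set X') ∩ (CategoryTheory.CategoryStruct.comp σ' (CategoryTheory.CategoryStruct.comp (AlgebraicGeometry.Proj.toSpecZero (MvPolynomial.homogeneousSubmodule (Fin (n + 1)) O)) (AlgebraicGeometry.Spec.map (CommRingCat.ofHom (algebraMap O (MvPolynomial.homogeneousSubmodule (Fin (n + 1)) O 0)))))) ⁻¹' {IsLocalRing.closedPoint O} ⊆ Y' → Q X'' (CategoryTheory.CategoryStruct.comp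 τ σ') (closure (τ ⁻¹' (Y' \ (C.support : Set X'))))) → Q P' σ S') ∧ Literature.AlgebraicGeometry.Resolution.Scheme.IsRegular (AlgebraicGeometry.Scheme.IdealSheafData.vanishingIdeal (⟨closure S', isClosed_closure⟩ : TopologicalSpace.Closeds P')).subscheme) := by
  classical
  intro hp k _ _ _ n H ι hι hH hpr hres
  obtain ⟨O, i1, i2, i3, i4, i5, i6, π, hπ⟩ := stub_wittRing p hp k
  refine ⟨O, i1, i2, i3, i4, π, hπ, ?_⟩
  letI := MvPolynomial.gradedAlgebra (σ := Fin (n + 1)) (R := O)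
  letI := MvPolynomial.gradedAlgebra (σ := Fin (n + 1)) (R := k)
  intro φ hφ' hφ Y hYdef
  subst hYdef
  -- the fixed ambient `P = ℙⁿ_O`, its structure morphism `q`, and the closed immersion `g : ℙⁿ_k ⟶ ℙⁿ_O` onto the special fibre
  set q : Proj (homogeneousSubmodule (Fin (n + 1)) O) ⟶ Spec (.of O) :=
    Proj.toSpecZero (homogeneousSubmodule (Fin (n + 1)) O) ≫
      Spec.map (CommRingCat.ofHom (algebraMap O (homogeneousSubmodule (Fin (n + 1)) O 0))) with hq
  have hP := ProjectiveAmbientFibre.isPullback_projMap π φ hφ hπ hφ'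
  set g : Proj (homogeneousSubmodule (Fin (n + 1)) k) ⟶ Proj (homogeneousSubmodule (Fin (n + 1)) O) :=
    Proj.map φ hφ' with hg
  haveI : IsClosedImmersion (Spec.map (CommRingCat.ofHom π)) := IsClosedImmersion.spec_of_surjective _ hπ
  haveI : IsClosedImmersion g := MorphismProperty.IsStableUnderBaseChange.of_isPullback hP.flip inferInstance
  have hpt : ∀ x : Spec (.of k), Spec.map (CommRingCat.ofHom π) x = IsLocalRing.closedPoint O := by
    intro x
    rw [Spec.map_apply]
    apply PrimeSpectrum.ext
    rw [PrimeSpectrum.comap_asIdeal, CommRingCat.hom_ofHom, Ideal.eq_bot_of_prime x.asIdeal, ← RingHom.ker_eq_comap_bot]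
    exact IsLocalRing.eq_maximalIdeal (RingHom.ker_isMaximal_of_surjective π hπ)
  have hgq : ∀ x, q (g x) = IsLocalRing.closedPoint O := fun x ↦
    (Scheme.Hom.comp_apply g q x).symm.trans
      ((congrArg (fun h : Proj (homogeneousSubmodule (Fin (n + 1)) k) ⟶ Spec (.of O) ↦ h x) hP.w).trans
        ((Scheme.Hom.comp_apply _ _ x).trans (hpt _)))
  -- the closed immersion `f = ι ≫ g : H ⟶ ℙⁿ_O` and its (closed) range `Y`
  haveI := hH
  let ι' : H ⟶ Proj (homogeneousSubmodule (Fin (n + 1)) k) := ι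
  haveI : IsClosedImmersion ι' := hι
  let f : H ⟶ Proj (homogeneousSubmodule (Fin (n + 1)) O) := ι' ≫ g
  let Yc : Closeds (Proj (homogeneousSubmodule (Fin (n + 1)) O)) := ⟨Set.range f, f.isClosedEmbedding.isClosed_range⟩
  have hYc : (Yc : Set (Proj (homogeneousSubmodule (Fin (n + 1)) O))) = Set.range (ι ≫ Proj.map φ hφ') := rfl
  have hsub : (Yc : Set (Proj (homogeneousSubmodule (Fin (n + 1)) O))) ⊆ q ⁻¹' {IsLocalRing.closedPoint O} := by
    rintro _ ⟨x, rfl⟩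
    show q (f x) = IsLocalRing.closedPoint O
    rw [show f x = g (ι' x) from Scheme.Hom.comp_apply _ _ x]
    exact hgq (ι' x)
  obtain ⟨hsm, hprop⟩ := stub_projectiveAmbientSmoothProper O n
  -- `H` is reduced: `V(Y)_red ≅ H` upstairs and `V(range ι)_red ≅ H` downstairs
  obtain ⟨e⟩ := nonempty_iso_subscheme_vanishingIdeal_range f
  obtain ⟨eD⟩ := nonempty_iso_subscheme_vanishingIdeal_range ι'
  -- the special fibre of `ℙⁿ_O` is irreducible
  obtain ⟨-, -, -, hirr₀⟩ := stub_projectiveAmbientFibre O k π hπ n H ι hι hH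
  -- generic point of `Y`; `Y` irreducible
  let ι₀ : H ⟶ Proj (homogeneousSubmodule (Fin (n + 1)) O) := e.inv ≫ (vanishingIdeal Yc).subschemeι
  have hrange : Set.range ι₀ = (Yc : Set (Proj (homogeneousSubmodule (Fin (n + 1)) O))) := by
    rw [← Scheme.IdealSheafData.coe_support_vanishingIdeal Yc, ← Scheme.IdealSheafData.range_subschemeι]
    ext x
    constructor
    · rintro ⟨h, rfl⟩
      exact ⟨e.inv h, (Scheme.Hom.comp_apply _ _ h).symm⟩
    · rintro ⟨y, rfl⟩
      obtain ⟨h, rfl⟩ := e.inv.surjective y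
      exact ⟨h, Scheme.Hom.comp_apply _ _ h⟩
  have hYirr : IsIrreducible (Yc : Set (Proj (homogeneousSubmodule (Fin (n + 1)) O))) := by
    have h := (IrreducibleSpace.isIrreducible_univ H).image ι₀ ι₀.continuous.continuousOn
    rwa [Set.image_univ, hrange] at h
  -- EL♮'s HORIZONTAL induction principle as a stage predicate over the fixed base
  obtain ⟨Ch, hCh⟩ : ∃ Ch : ∀ X' : Scheme.{0}, (X' ⟶ Proj (homogeneousSubmodule (Fin (n + 1)) O)) → Set X' → Prop,
      ∀ (X₁ : Scheme.{0}) (σ₁ : X₁ ⟶ Proj (homogeneousSubmodule (Fin (n + 1)) O)) (S₁ : Set X₁), Ch X₁ σ₁ S₁ ↔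
      ∀ Q : (∀ X' : Scheme.{0}, (X' ⟶ Proj (homogeneousSubmodule (Fin (n + 1)) O)) → Set X' → Prop),
        Q (Proj (homogeneousSubmodule (Fin (n + 1)) O)) (𝟙 _) (Yc : Set (Proj (homogeneousSubmodule (Fin (n + 1)) O))) →
        (∀ (X' X'' : Scheme.{0}) (σ' : X' ⟶ Proj (homogeneousSubmodule (Fin (n + 1)) O)) (Y' : Set X')
          (C : X'.IdealSheafData) (τ : X'' ⟶ X'), Q X' σ' Y' → IsBlowup τ C → Scheme.IsRegular C.subscheme →
          Flat (C.subschemeι ≫ σ' ≫ q) →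
          σ' '' (C.support : Set X') ⊆ {x | ¬ IsGenericPoint x (Yc : Set (Proj (homogeneousSubmodule (Fin (n + 1)) O)))} →
          (C.support : Set X') ∩ (σ' ≫ q) ⁻¹' {IsLocalRing.closedPoint O} ⊆ Y' →
          Q X'' (τ ≫ σ') (closure (τ ⁻¹' (Y' \ (C.support : Set X'))))) →
        Q X₁ σ₁ S₁ := ⟨_, fun _ _ _ => Iff.rfl⟩
  have hChain : ∀ (X' : Scheme.{0}) (σ : X' ⟶ Proj (homogeneousSubmodule (Fin (n + 1)) O)) (S : Set X'),
      Ch X' σ S → Chain (Proj (homogeneousSubmodule (Fin (n + 1)) O))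
        (Yc : Set (Proj (homogeneousSubmodule (Fin (n + 1)) O))) X' σ S :=
    fun X' σ S h Q h0 hs => (hCh X' σ S).mp h Q h0
      (fun X₁ X₂ σ' Y' C τ hQ hb hr _ hg' _ => hs X₁ X₂ σ' Y' C τ hQ hb hr hg')
  have hStep : ∀ (X' X'' : Scheme.{0}) (σ' : X' ⟶ Proj (homogeneousSubmodule (Fin (n + 1)) O)) (S' : Set X')
      (C : X'.IdealSheafData) (τ : X'' ⟶ X'),
      Ch X' σ' S' → IsBlowup τ C → Scheme.IsRegular C.subscheme → Flat (C.subschemeι ≫ σ' ≫ q) →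
      σ' '' (C.support : Set X') ⊆ {x | ¬ IsGenericPoint x (Yc : Set (Proj (homogeneousSubmodule (Fin (n + 1)) O)))} →
      (C.support : Set X') ∩ (σ' ≫ q) ⁻¹' {IsLocalRing.closedPoint O} ⊆ S' →
      Ch X'' (τ ≫ σ') (closure (τ ⁻¹' (S' \ (C.support : Set X')))) :=
    fun X' X'' σ' S' C τ h hb hr hfl hg' hE => (hCh _ _ _).mpr fun Q h0 hs =>
      hs X' X'' σ' S' C τ ((hCh X' σ' S').mp h Q h0 hs) hb hr hfl hg' hE
  have hCh₀ : Ch (Proj (homogeneousSubmodule (Fin (n + 1)) O)) (𝟙 _)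
      (Yc : Set (Proj (homogeneousSubmodule (Fin (n + 1)) O))) := (hCh _ _ _).mpr fun Q h0 _ => h0
  -- THE DOWNSTAIRS INDUCTION PREDICATE: closed irreducible strict transform, locally Noetherian ambient, and an upstairs
  -- horizontal-E1 stage whose reduced strict transform is ISOMORPHIC to the downstairs one
  let QD : ∀ F₁ : Scheme.{0}, (F₁ ⟶ (Literature.AlgebraicGeometry.Motives.projectiveSpace n k).left) → Set F₁ → Prop :=
    fun F₁ _ T₁ => IsClosed T₁ ∧ IsLocallyNoetherian F₁ ∧ IsIrreducible T₁ ∧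
      ∃ (X' : Scheme.{0}) (σ' : X' ⟶ Proj (homogeneousSubmodule (Fin (n + 1)) O)) (S' : Set X'),
        Ch X' σ' S' ∧ IsIrreducible ((σ' ≫ q) ⁻¹' {IsLocalRing.closedPoint O}) ∧
        (∀ w : X', (σ' ≫ q) w = IsLocalRing.closedPoint O → GoodAt (σ' ≫ q) w) ∧
        Nonempty ((vanishingIdeal (⟨closure T₁, isClosed_closure⟩ : Closeds F₁)).subscheme ≅
          (vanishingIdeal (⟨closure S', isClosed_closure⟩ : Closeds X')).subscheme)
  obtain ⟨F', ρ', T', hclos, hregD⟩ := hres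
  have hQD : QD F' ρ' T' := by
    refine hclos QD ?_ ?_
    · -- BASE: `(ℙⁿ_k, 𝟙, range ι)` against `(ℙⁿ_O, 𝟙, Y)`
      have hPOnoeth : IsLocallyNoetherian (Proj (homogeneousSubmodule (Fin (n + 1)) O)) :=
        LocallyOfFiniteType.isLocallyNoetherian q
      haveI := hPOnoeth
      have hPknoeth : IsLocallyNoetherian (Proj (homogeneousSubmodule (Fin (n + 1)) k)) :=
        LocallyOfFiniteType.isLocallyNoetherian g
      have hirrι : IsIrreducible (Set.range ι') := by
        have h := (IrreducibleSpace.isIrreducible_univ H).image ι' ι'.continuous.continuousOn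
        rwa [Set.image_univ] at h
      refine ⟨ι'.isClosedEmbedding.isClosed_range, hPknoeth, hirrι, _, 𝟙 _,
        (Yc : Set (Proj (homogeneousSubmodule (Fin (n + 1)) O))), hCh₀, ?_, ?_, ?_⟩
      · simpa only [Category.id_comp] using hirr₀
      · intro w _
        rw [Category.id_comp]
        exact stub_goodAtOfSmooth O _ _ hsm w
      · haveI hιinst : IsClosedImmersion ι := hι
        have hZ1 : (⟨closure (Set.range ι), isClosed_closure⟩ :
            Closeds (Literature.AlgebraicGeometry.Motives.projectiveSpace n k).left) =
            ⟨Set.range ι, ι.isClosedEmbedding.isClosed_range⟩ := Closeds.ext ι.isClosedEmbedding.isClosed_range.closure_eq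
        have hZ2 : (⟨closure (Yc : Set (Proj (homogeneousSubmodule (Fin (n + 1)) O))), isClosed_closure⟩ :
            Closeds (Proj (homogeneousSubmodule (Fin (n + 1)) O))) = Yc := Closeds.ext Yc.isClosed.closure_eq
        rw [hZ1, hZ2]
        exact ⟨eD ≪≫ e.symm⟩
    · -- STEP: `pointStep`
      intro F₁ F₂ ρ T₁ x υ hx hQ₁ hxreg hυ
      obtain ⟨hT₁cl, hF₁, hT₁irr, X', σ', S', hChX, hirrX, hgoodX, ⟨eX⟩⟩ := hQ₁
      haveI := hF₁
      obtain ⟨X'', σ'', S'', hCh'', hirr'', hgood'', hF₂, hT₂irr, hiso⟩ :=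
        pointStep O _ q Yc Ch hChain hStep hsm hprop hsub hYirr X' σ' S' hChX hirrX hgoodX F₁ F₂ T₁ hT₁cl hT₁irr x hx hxreg
          υ hυ eX
      exact ⟨isClosed_closure, hF₂, hT₂irr, X'', σ'', S'', hCh'', hirr'', hgood'', hiso⟩
  -- THE END: transport the downstairs regularity through the isomorphism
  obtain ⟨-, -, -, X₁, σ₁, S₁, hCh₁, -, -, ⟨e₁⟩⟩ := hQD
  exact ⟨X₁, σ₁, S₁, (hCh X₁ σ₁ S₁).mp hCh₁, Scheme.IsRegular.of_iso e₁.hom hregD⟩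

end Summit.ResolutionOfSingularities.ResolutionOfSingularities.Cruxes.EquisingularLiftNat.Sections

end
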